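import Literature.NumberTheory.PAdicHodge.TateInvariantsBase
import HarnessLib

/-!
# Tate's eigenvector lemma with coefficients: `γ x⃗ = A x⃗` on `X^κ` forces `x⃗ = 0`

Topic `Literature/NumberTheory/PAdicHodge`; namespace `Literature.NumberTheory.PAdicHodge.TateTrace`. THEOREMS ONLY (no definition,
no instance, no notation, no named fact). Continuation of `TateInvariantsBase`; notation as there:
`K₀ = PadicBase F p hp ≅ ℚ_p`, `F̄ = NormedAlgClosure F`, `ℂ_F = CompletedAlgClosure F`, `G₀ = BaseGaloisGroup hp = Gal(F̄/K₀)`,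
`ζ_{p^M} = zeta F p M`, `K_∞ = K₀(μ_{p^∞})`, `S` its image in `ℂ_F`, `X = \widehat{K_∞}` its closure, `γ = gen n`,
`R_n = Rhat n : X → ℂ_F` (Tate's normalised trace extended to `X`), `ι : K₀ → ℂ_F`.

`TateInvariantsBase` proves Tate's theorem `ℂ_F(χ^j)^{G₀} = 0` for the INTEGER POWERS of the cyclotomic character: its
eigenvector lemma `TateTrace.eq_zero_of_gen_smul_eq` takes a SCALAR eigenvalue `c ∈ K₀`. A character with values in a finite
extension `E` of `ℚ_p` — e.g. `ψ = ρ · χ^{-n}` for a rank-one de Rham `ρ : Γ → E^×`, the situation of Tate's theorem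
"Hodge–Tate of weight `0` ⇒ finite on inertia" that the local hypothesis of
`FramedGaloisRep.exists_heckeCharacter_of_isDeRhamFramed_of_local` asks for — is not of this shape over `K₀`; through the regular
representation `E ↪ Matrix κ κ K₀` (Mathlib `Algebra.leftMulMatrix`) the invariance of a period becomes a `K₀`-MATRIX eigenvalue
equation for its coordinate vector. This file proves the matrix form of the lemma:

* `zero_mem_X`, `sum_mem_X`, `Rhat_zero`, `Rhat_sum`, `Rhat_sum_ι_mul` — `X` is an additive subgroup of `ℂ_F` and
  `R_n : X → ℂ_F` is additive (by density from `traceToLevel_add`; the two-term versions `X_add_mem`, `Rhat_map_add` exist in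
  `TateLogCyclotomicClass`, whose heavier imports we avoid by private copies), hence `K₀`-linear on FINITE SUMS;
* `base_smul_eq_of_forall_smul_zeta_eq` — two elements of `G₀` with the same action on every `ζ_{p^M}` act identically on `X`
  (Ax–Sen–Tate, `fixedPoints_eq_X`); `gen_smul_zeta_of_le` — `γ = gen n` fixes `ζ_{p^M}` for `M ≤ n`;
* ★ `eq_zero_of_gen_smul_eq_mulVec` — **if `x⃗ ∈ X^κ` (`κ` finite), `A ∈ Matrix κ κ K₀` with `A − 1` invertible and
  `‖p‖⁻² ‖(A − 1)_{k m}‖ < 1` for all `k, m`, and `γ • x_k = Σ_m ι(A_{k m}) x_m` for all `k`, then `x⃗ = 0`**: applying the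
  additive, `K₀`-linear, `γ`-absorbing `R_n` gives `(A − 1) · R_n x⃗ = 0`, so `R_n x⃗ = 0`; at a coordinate `k₀` of maximal norm,
  Tate's estimate `‖x − R_n x‖ ≤ ‖p‖⁻² ‖γ x − x‖` and the ultrametric inequality give
  `‖x_{k₀}‖ ≤ max_m ‖p‖⁻² ‖(A − 1)_{k₀ m}‖ ‖x_m‖ < ‖x_{k₀}‖`; `eq_zero_of_smul_eq_mulVec` — the same for ANY `γ' ∈ G₀` acting
  like `γ` on `μ_{p^∞}`;
* ★ `eq_one_of_gen_smul_eq_leftMulMatrix` — **coefficient form**: for a field `E ⊇ K₀` with a finite `K₀`-basis `b`, an `e ∈ E`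
  with `‖p‖⁻² ‖(L_e − 1)_{k m}‖ < 1` (`L_e = Algebra.leftMulMatrix b e`) and a NONZERO `x⃗ ∈ X^κ` with
  `γ • x_k = Σ_m ι((L_e)_{k m}) x_m` force `e = 1` (for `e ≠ 1`, `L_e − 1 = L_{e−1}` is invertible).

This is the `H⁰` half of Tate's theorem on `C(χ)` for characters `χ` of infinite order [Tate1967, §3.3, Theorem 2 and its
proof] in the form needed for coefficient fields `E ≠ ℚ_p` [SerreAbelianLadic1968, Ch. III, Appendix]; the tree had it for
`E = ℚ_p`, `χ = χ_cyc^j` (`CompletedAlgClosure.eq_zero_of_forall_base_smul_eq`). Section numbers for [Tate1967] and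
[FontaineOuyang2022] follow the citations of `TateInvariantsBase`.

## References

* J. Tate, *p-divisible groups* (1967), §3.1–§3.3 (normalised traces; Prop. 7; Theorem 2). [Tate1967]
* J.-P. Serre, *Abelian ℓ-adic representations and elliptic curves* (1968), Ch. III, Appendix (Hodge–Tate modules with
  coefficients and Tate's theorem). [SerreAbelianLadic1968]
* J.-M. Fontaine, Y. Ouyang, *Theory of p-adic Galois representations*, §3.1–§3.2. [FontaineOuyang2022]
-/

noncomputable section

open ValuativeRel Field UniformSpace Filter Topology Finset

open scoped IntermediateField Matrix

namespace Literature.NumberTheory.PAdicHodge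

open Literature.NumberTheory.GaloisRepresentations
open Literature.NumberTheory.GaloisRepresentations.IsNonarchimedeanLocalField
open CyclotomicTower

variable {F : Type} [Field F] [ValuativeRel F] [TopologicalSpace F] [IsNonarchimedeanLocalField F]
  [CharZero F] {p : ℕ} [Fact p.Prime] (hp : valuation F p < 1) {n : ℕ}

namespace TateTrace

/-! ### `X` is an additive subgroup of `ℂ_F` -/

/-- `0 ∈ S`. [folklore] -/
private theorem S_zero_mem : (0 : CompletedAlgClosure F) ∈ S hp := by
  have h := coe_mem_S hp (zero_mem (Kinf hp))
  rwa [Completion.coe_zero] at h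

/-- `S` is closed under addition. [folklore] -/
private theorem S_add_mem {s t : CompletedAlgClosure F} (hs : s ∈ S hp) (ht : t ∈ S hp) : s + t ∈ S hp := by
  obtain ⟨y, hy, rfl⟩ := (mem_S_iff hp).mp hs
  obtain ⟨z, hz, rfl⟩ := (mem_S_iff hp).mp ht
  exact (mem_S_iff hp).mpr ⟨y + z, add_mem hy hz, Completion.coe_add y z⟩

/-- `0 ∈ X = \\widehat{K_∞}` (a closed subfield of `ℂ_F`). [cite: Tate1967, §3.1] -/
theorem zero_mem_X : (0 : CompletedAlgClosure F) ∈ X hp := S_subset_X hp (S_zero_mem hp)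

/-- `X = \\widehat{K_∞}` is closed under addition (private copy of `TateLogCyclotomicClass.add_mem_X`, keeping the
import closure of this file at `TateInvariantsBase`). [cite: Tate1967, §3.1] -/
private theorem X_add_mem {x y : CompletedAlgClosure F} (hx : x ∈ X hp) (hy : y ∈ X hp) : x + y ∈ X hp :=
  map_mem_closure₂ continuous_add hx hy fun _ ha _ hb => S_add_mem hp ha hb

/-- `X = \\widehat{K_∞}` is closed under finite sums. [cite: Tate1967, §3.1] -/
theorem sum_mem_X {κ : Type} (s : Finset κ) (f : κ → CompletedAlgClosure F) (hf : ∀ i ∈ s, f i ∈ X hp) :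
    ∑ i ∈ s, f i ∈ X hp :=
  Finset.sum_induction f (· ∈ X hp) (fun _ _ ha hb => X_add_mem hp ha hb) (zero_mem_X hp) hf

/-! ### Additivity of `R_n` -/

/-- Additivity of `R_n` on `S` (private copy of `TateLogCyclotomicClass.Rfun_add`). [cite: Tate1967, §3.1] -/
private theorem Rfun_map_add (hn : 1 ≤ n) (s t : S hp) (h : (s : CompletedAlgClosure F) + t ∈ S hp) :
    Rfun hp n ⟨(s : CompletedAlgClosure F) + t, h⟩ = Rfun hp n s + Rfun hp n t := by
  obtain ⟨y, z, M, hy, hz, hM, hyM, hzM⟩ := exists_common_level hp n s t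
  have hyz : ((y + z : NormedAlgClosure F) : CompletedAlgClosure F) = (s : CompletedAlgClosure F) + t := by
    rw [Completion.coe_add, hy, hz]
  rw [Rfun_eq hp hn (s := ⟨(s : CompletedAlgClosure F) + t, h⟩) hyz hM (add_mem hyM hzM), traceToLevel_add,
    Completion.coe_add, Rfun_eq hp hn hy hM hyM, Rfun_eq hp hn hz hM hzM]

/-- Additivity of `R_n` on `X`, by density of `S × S` in `X × X` (private copy of `TateLogCyclotomicClass.Rhat_add`).
[cite: Tate1967, §3.1] [cite: FontaineOuyang2022, §3.1] -/
private theorem Rhat_map_add (hn : 2 ≤ n) (x y : X hp) :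
    Rhat hp n ⟨(x : CompletedAlgClosure F) + y, X_add_mem hp x.2 y.2⟩ = Rhat hp n x + Rhat hp n y := by
  have hd : DenseRange (Prod.map (incl hp) (incl hp)) := (denseRange_incl hp).prodMap (denseRange_incl hp)
  have hc : Continuous fun q : X hp × X hp =>
      (⟨(q.1 : CompletedAlgClosure F) + q.2, X_add_mem hp q.1.2 q.2.2⟩ : X hp) :=
    ((continuous_subtype_val.comp continuous_fst).add (continuous_subtype_val.comp continuous_snd)).subtype_mk _
  refine isClosed_property hd
    (p := fun q : X hp × X hp =>
      Rhat hp n ⟨(q.1 : CompletedAlgClosure F) + q.2, X_add_mem hp q.1.2 q.2.2⟩ = Rhat hp n q.1 + Rhat hp n q.2)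
    (isClosed_eq ((continuous_Rhat hp hn).comp hc)
      (((continuous_Rhat hp hn).comp continuous_fst).add ((continuous_Rhat hp hn).comp continuous_snd)))
    (fun q => ?_) (x, y)
  obtain ⟨s, t⟩ := q
  have hmem : (s : CompletedAlgClosure F) + t ∈ S hp := S_add_mem hp s.2 t.2
  have h1 : (⟨((incl hp s : X hp) : CompletedAlgClosure F) + (incl hp t : X hp), X_add_mem hp (incl hp s).2 (incl hp t).2⟩ : X hp) =
      incl hp ⟨(s : CompletedAlgClosure F) + t, hmem⟩ := rfl
  show Rhat hp n ⟨((incl hp s : X hp) : CompletedAlgClosure F) + (incl hp t : X hp), X_add_mem hp (incl hp s).2 (incl hp t).2⟩ =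
      Rhat hp n (incl hp s) + Rhat hp n (incl hp t)
  rw [h1, Rhat_incl hp hn, Rhat_incl hp hn, Rhat_incl hp hn, Rfun_map_add hp (by omega)]

/-- `R_n 0 = 0` (`R_n` is `K₀`-linear). [cite: Tate1967, §3.1] [cite: FontaineOuyang2022, §3.1] -/
theorem Rhat_zero (hn : 2 ≤ n) (h0 : (0 : CompletedAlgClosure F) ∈ X hp) : Rhat hp n ⟨0, h0⟩ = 0 := by
  have h1 : (⟨0, h0⟩ : X hp) = mulX hp 0 ⟨0, h0⟩ :=
    Subtype.ext (show (0 : CompletedAlgClosure F) = ι hp 0 * 0 by rw [mul_zero])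
  rw [h1, Rhat_mulX hp hn, ← ιHom_apply, map_zero, zero_mul]

/-- **`R_n` of a finite sum** of elements of `X` (additivity of the extended trace). [cite: Tate1967, §3.1]
[cite: FontaineOuyang2022, §3.1] -/
theorem Rhat_sum (hn : 2 ≤ n) {κ : Type} (s : Finset κ) (f : κ → CompletedAlgClosure F) (hf : ∀ i, f i ∈ X hp)
    (hs : ∑ i ∈ s, f i ∈ X hp) : Rhat hp n ⟨∑ i ∈ s, f i, hs⟩ = ∑ i ∈ s, Rhat hp n ⟨f i, hf i⟩ := by
  induction s using Finset.cons_induction with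
  | empty =>
    have h : (⟨∑ i ∈ (∅ : Finset κ), f i, hs⟩ : X hp) = ⟨0, zero_mem_X hp⟩ :=
      Subtype.ext (show ∑ i ∈ (∅ : Finset κ), f i = 0 from Finset.sum_empty)
    rw [h, Rhat_zero hp hn, Finset.sum_empty]
  | cons a s ha ih =>
    have h : (⟨∑ i ∈ Finset.cons a s ha, f i, hs⟩ : X hp) =
        ⟨((⟨f a, hf a⟩ : X hp) : CompletedAlgClosure F) + (⟨∑ i ∈ s, f i, sum_mem_X hp s f fun i _ => hf i⟩ : X hp),
          X_add_mem hp (hf a) (sum_mem_X hp s f fun i _ => hf i)⟩ :=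
      Subtype.ext (Finset.sum_cons ha)
    rw [h, Rhat_map_add hp hn, ih, Finset.sum_cons]

/-- **`R_n` of a `K₀`-linear combination**: `R_n (Σ_m ι(a_m) x_m) = Σ_m ι(a_m) R_n x_m` (`K₀`-linearity of the
extended trace). [cite: Tate1967, §3.1] [cite: FontaineOuyang2022, §3.1] -/
theorem Rhat_sum_ι_mul (hn : 2 ≤ n) {κ : Type} [Fintype κ] (a : κ → PadicBase F p hp)
    (x : κ → CompletedAlgClosure F) (hx : ∀ m, x m ∈ X hp) (h : ∑ m, ι hp (a m) * x m ∈ X hp) :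
    Rhat hp n ⟨∑ m, ι hp (a m) * x m, h⟩ = ∑ m, ι hp (a m) * Rhat hp n ⟨x m, hx m⟩ :=
  (Rhat_sum hp hn Finset.univ (fun m => ι hp (a m) * x m) (fun m => ι_mul_mem_X hp (a m) (hx m)) h).trans
    (Finset.sum_congr rfl fun m _ => Rhat_mulX hp hn (a m) ⟨x m, hx m⟩)

/-! ### Elements of `G₀` acting alike on `μ_{p^∞}` -/

/-- Two elements of `G₀` with the same action on every `ζ_{p^M}` act identically on `X = \widehat{K_∞}`
(Ax–Sen–Tate `fixedPoints_eq_X`). [cite: Tate1967, §3.3 Theorem 1] -/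
theorem base_smul_eq_of_forall_smul_zeta_eq {g g' : BaseGaloisGroup hp}
    (h : ∀ M, g • zeta F p M = g' • zeta F p M) {x : CompletedAlgClosure F} (hx : x ∈ X hp) :
    g • x = g' • x := by
  have hx' : x ∈ {x : CompletedAlgClosure F |
      ∀ g : BaseGaloisGroup hp, (∀ M, g • zeta F p M = zeta F p M) → g • x = x} := by
    rw [fixedPoints_eq_X hp]; exact hx
  have hfix : (g'⁻¹ * g) • x = x :=
    hx' _ fun M => by rw [mul_smul, h M, ← mul_smul, inv_mul_cancel, one_smul]
  calc g • x = (g' * (g'⁻¹ * g)) • x := by rw [mul_inv_cancel_left]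
    _ = g' • x := by rw [mul_smul, hfix]

/-- `γ = gen n` fixes `ζ_{p^M}` for every `M ≤ n` (so `γ ∈ Gal(F̄/K n)`). [cite: Tate1967, §3.1] -/
theorem gen_smul_zeta_of_le {M : ℕ} (hn : 1 ≤ n) (hM : M ≤ n) : gen hp n • zeta F p M = zeta F p M := by
  obtain ⟨i, hi⟩ := exists_zeta_eq_pow (F := F) (p := p) (show M ≤ n + 1 by omega)
  have h1 : gen hp n • zeta F p M = zeta F p M ^ (1 + p ^ n) := by
    rw [hi, smul_pow', gen_smul_zeta hp hn, ← pow_mul, ← pow_mul, mul_comm]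
  have h2 : zeta F p M ^ p ^ n = 1 := by
    obtain ⟨k, hk⟩ := Nat.exists_eq_add_of_le hM
    rw [hk, pow_add, pow_mul, (zeta_spec F p M).pow_eq_one, one_pow]
  rw [h1, pow_add, pow_one, h2, mul_one]

/-! ### The eigenvector lemma with matrix coefficients -/

/-- ★ **Tate's eigenvector lemma with matrix coefficients.** Let `n ≥ 2`, `κ` a finite index type,
`x⃗ : κ → ℂ_F` with every `x_k ∈ X = \widehat{K_∞}`, and `A ∈ Matrix κ κ K₀` with `A - 1` invertible and
`‖p‖⁻² ‖(A - 1)_{k m}‖ < 1` for all `k, m`. If `γ • x_k = Σ_m ι(A_{k m}) x_m` for every `k`, then `x⃗ = 0`: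
`R_n x⃗ = R_n (γ x⃗) = A · R_n x⃗` forces `R_n x⃗ = 0` (`A - 1` stays invertible over `ℂ_F`), and at a coordinate
`k₀` of maximal norm Tate's estimate gives `‖x_{k₀}‖ = ‖x_{k₀} - R_n x_{k₀}‖ ≤ ‖p‖⁻² ‖Σ_m ι((A-1)_{k₀ m}) x_m‖
≤ max_m ‖p‖⁻² ‖(A-1)_{k₀ m}‖ ‖x_{k₀}‖ < ‖x_{k₀}‖`. [cite: Tate1967, §3.3 (proof of Theorem 2)]
[cite: SerreAbelianLadic1968, Ch. III, Appendix] -/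
theorem eq_zero_of_gen_smul_eq_mulVec (hn : 2 ≤ n) {κ : Type} [Fintype κ] [DecidableEq κ]
    {x : κ → CompletedAlgClosure F} (hx : ∀ k, x k ∈ X hp) {A : Matrix κ κ (PadicBase F p hp)}
    (hA : IsUnit (A - 1))
    (hsmall : ∀ k m, ‖(p : PadicBase F p hp)‖⁻¹ ^ 2 * ‖(A - 1) k m‖ < 1)
    (hγ : ∀ k, gen hp n • x k = ∑ m, ι hp (A k m) * x m) : x = 0 := by
  -- (1) `r = R_n x⃗` satisfies `r = A · r`
  set r : κ → CompletedAlgClosure F := fun k => Rhat hp n ⟨x k, hx k⟩ with hr_def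
  have hr : ∀ k, r k = ∑ m, ι hp (A k m) * r m := by
    intro k
    have hmem : ∑ m, ι hp (A k m) * x m ∈ X hp :=
      sum_mem_X hp _ _ fun m _ => ι_mul_mem_X hp (A k m) (hx m)
    have h1 : genX hp n ⟨x k, hx k⟩ = ⟨∑ m, ι hp (A k m) * x m, hmem⟩ := Subtype.ext (hγ k)
    calc r k = Rhat hp n (genX hp n ⟨x k, hx k⟩) := (Rhat_genX hp hn _).symm
      _ = Rhat hp n ⟨∑ m, ι hp (A k m) * x m, hmem⟩ := by rw [h1]
      _ = ∑ m, ι hp (A k m) * r m := Rhat_sum_ι_mul hp hn (fun m => A k m) x hx hmem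
  -- (2) `r = 0`, since `A - 1` is invertible over `ℂ_F` too
  have hr0 : r = 0 := by
    have hBr : (ιHom hp).mapMatrix (A - 1) *ᵥ r = 0 := by
      funext k
      rw [map_sub, map_one, Matrix.sub_mulVec, Matrix.one_mulVec, Pi.sub_apply, Pi.zero_apply, sub_eq_zero]
      simp only [Matrix.mulVec, dotProduct, RingHom.mapMatrix_apply, Matrix.map_apply, ιHom_apply]
      exact (hr k).symm
    obtain ⟨u, hu⟩ := hA.map (ιHom hp).mapMatrix
    calc r = (1 : Matrix κ κ (CompletedAlgClosure F)) *ᵥ r := (Matrix.one_mulVec r).symm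
      _ = ((↑u⁻¹ : Matrix κ κ (CompletedAlgClosure F)) * ↑u) *ᵥ r := by rw [Units.inv_mul]
      _ = (↑u⁻¹ : Matrix κ κ (CompletedAlgClosure F)) *ᵥ ((ιHom hp).mapMatrix (A - 1) *ᵥ r) := by
          rw [← Matrix.mulVec_mulVec, hu]
      _ = 0 := by rw [hBr, Matrix.mulVec_zero]
  -- (3) the estimate at a coordinate of maximal norm
  rcases isEmpty_or_nonempty κ with hκ | hκ
  · funext k; exact isEmptyElim k
  obtain ⟨k₀, -, hk₀⟩ := Finset.exists_max_image Finset.univ (fun k => ‖x k‖) Finset.univ_nonempty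
  suffices h0 : x k₀ = 0 by
    funext k
    have hk : ‖x k‖ ≤ ‖x k₀‖ := hk₀ k (Finset.mem_univ k)
    rw [h0, norm_zero] at hk
    exact norm_le_zero_iff.mp hk
  by_contra hne
  have hpos : 0 < ‖x k₀‖ := norm_pos_iff.mpr hne
  have hRk0 : Rhat hp n ⟨x k₀, hx k₀⟩ = 0 := congr_fun hr0 k₀
  have hest := norm_sub_Rhat_le hp hn ⟨x k₀, hx k₀⟩
  rw [hRk0, sub_zero] at hest
  change ‖x k₀‖ ≤ ‖(p : PadicBase F p hp)‖⁻¹ ^ 2 * ‖gen hp n • x k₀ - x k₀‖ at hest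
  -- `γ x_{k₀} - x_{k₀} = Σ_m ι((A - 1)_{k₀ m}) x_m`
  have hsub : ∀ a b : PadicBase F p hp, ι hp (a - b) = ι hp a - ι hp b := fun a b => map_sub (ιHom hp) a b
  have hone : ∑ m, ι hp ((1 : Matrix κ κ (PadicBase F p hp)) k₀ m) * x m = x k₀ := by
    rw [Finset.sum_eq_single k₀, Matrix.one_apply_eq, ← ιHom_apply, map_one, one_mul]
    · intro m _ hm; rw [Matrix.one_apply_ne' hm, ← ιHom_apply, map_zero, zero_mul]
    · intro h; exact absurd (Finset.mem_univ k₀) h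
  have hdiff : gen hp n • x k₀ - x k₀ = ∑ m, ι hp ((A - 1) k₀ m) * x m := by
    calc gen hp n • x k₀ - x k₀
        = ∑ m, ι hp (A k₀ m) * x m - ∑ m, ι hp ((1 : Matrix κ κ (PadicBase F p hp)) k₀ m) * x m := by
          rw [hγ k₀, hone]
      _ = ∑ m, ι hp ((A - 1) k₀ m) * x m := by
          rw [← Finset.sum_sub_distrib]
          exact Finset.sum_congr rfl fun m _ => by rw [Matrix.sub_apply, hsub, sub_mul]
  -- ultrametric bound of the sum by its largest term
  obtain ⟨m₁, -, hm₁⟩ :=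
    Finset.exists_max_image Finset.univ (fun m => ‖ι hp ((A - 1) k₀ m) * x m‖) Finset.univ_nonempty
  have hsum : ‖∑ m, ι hp ((A - 1) k₀ m) * x m‖ ≤ ‖ι hp ((A - 1) k₀ m₁) * x m₁‖ :=
    IsUltrametricDist.norm_sum_le_of_forall_le_of_nonneg (norm_nonneg _) fun m hm => hm₁ m hm
  have hC : 0 ≤ ‖(p : PadicBase F p hp)‖⁻¹ ^ 2 := pow_nonneg (inv_nonneg.mpr (norm_nonneg _)) 2
  have hlt : ‖x k₀‖ < ‖x k₀‖ :=
    calc ‖x k₀‖ ≤ ‖(p : PadicBase F p hp)‖⁻¹ ^ 2 * ‖∑ m, ι hp ((A - 1) k₀ m) * x m‖ := by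
          rw [← hdiff]; exact hest
      _ ≤ ‖(p : PadicBase F p hp)‖⁻¹ ^ 2 * ‖ι hp ((A - 1) k₀ m₁) * x m₁‖ := mul_le_mul_of_nonneg_left hsum hC
      _ = ‖(p : PadicBase F p hp)‖⁻¹ ^ 2 * ‖(A - 1) k₀ m₁‖ * ‖x m₁‖ := by rw [norm_mul, norm_ι, mul_assoc]
      _ ≤ ‖(p : PadicBase F p hp)‖⁻¹ ^ 2 * ‖(A - 1) k₀ m₁‖ * ‖x k₀‖ :=
          mul_le_mul_of_nonneg_left (hk₀ m₁ (Finset.mem_univ _)) (mul_nonneg hC (norm_nonneg _))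
      _ < 1 * ‖x k₀‖ := mul_lt_mul_of_pos_right (hsmall k₀ m₁) hpos
      _ = ‖x k₀‖ := one_mul _
  exact lt_irrefl _ hlt

/-- The matrix eigenvector lemma for ANY `γ' ∈ G₀` acting on `μ_{p^∞}` like `γ = gen n` (on `X` the two actions
coincide, `base_smul_eq_of_forall_smul_zeta_eq`). [cite: Tate1967, §3.3 (proof of Theorem 2)] -/
theorem eq_zero_of_smul_eq_mulVec (hn : 2 ≤ n) {γ' : BaseGaloisGroup hp}
    (hγ' : ∀ M, γ' • zeta F p M = gen hp n • zeta F p M) {κ : Type} [Fintype κ] [DecidableEq κ]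
    {x : κ → CompletedAlgClosure F} (hx : ∀ k, x k ∈ X hp) {A : Matrix κ κ (PadicBase F p hp)}
    (hA : IsUnit (A - 1))
    (hsmall : ∀ k m, ‖(p : PadicBase F p hp)‖⁻¹ ^ 2 * ‖(A - 1) k m‖ < 1)
    (hγ : ∀ k, γ' • x k = ∑ m, ι hp (A k m) * x m) : x = 0 :=
  eq_zero_of_gen_smul_eq_mulVec hp hn hx hA hsmall fun k =>
    (base_smul_eq_of_forall_smul_zeta_eq hp hγ' (hx k)).symm.trans (hγ k)

/-- ★ **Coefficient form.** Let `E` be a field over `K₀` with a finite `K₀`-basis `b : κ`, `e ∈ E`, and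
`L_e = Algebra.leftMulMatrix b e ∈ Matrix κ κ K₀` its regular representation, with `‖p‖⁻² ‖(L_e - 1)_{k m}‖ < 1`
for all `k, m`. If a NONZERO `x⃗ : κ → X` satisfies `γ • x_k = Σ_m ι((L_e)_{k m}) x_m` for every `k`, then `e = 1`:
otherwise `L_e - 1 = L_{e-1}` is invertible and `eq_zero_of_gen_smul_eq_mulVec` gives `x⃗ = 0`. (For a character
`η : G₀ → E^×` trivial on `Gal(F̄/K_∞)` and a nonzero `η`-semi-invariant period in `E ⊗ ℂ_F`, this is `η(γ) = 1`.)
[cite: Tate1967, §3.3 Theorem 2] [cite: SerreAbelianLadic1968, Ch. III, Appendix] -/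
theorem eq_one_of_gen_smul_eq_leftMulMatrix (hn : 2 ≤ n) {E : Type} [Field E] [Algebra (PadicBase F p hp) E]
    {κ : Type} [Fintype κ] [DecidableEq κ] (b : Module.Basis κ (PadicBase F p hp) E) {e : E}
    (hsmall : ∀ k m, ‖(p : PadicBase F p hp)‖⁻¹ ^ 2 * ‖(Algebra.leftMulMatrix b e - 1) k m‖ < 1)
    {x : κ → CompletedAlgClosure F} (hx : ∀ k, x k ∈ X hp) (hx0 : x ≠ 0)
    (hγ : ∀ k, gen hp n • x k = ∑ m, ι hp (Algebra.leftMulMatrix b e k m) * x m) : e = 1 := by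
  by_contra hne
  have hu : IsUnit (Algebra.leftMulMatrix b e - 1) := by
    have h1 : Algebra.leftMulMatrix b e - 1 = Algebra.leftMulMatrix b (e - 1) := by rw [map_sub, map_one]
    rw [h1]
    exact (sub_ne_zero.mpr hne).isUnit.map _
  exact hx0 (eq_zero_of_gen_smul_eq_mulVec hp hn hx hu hsmall hγ)

end TateTrace

end Literature.NumberTheory.PAdicHodge

end
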